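import Summits.KontsevichZagierPeriods.KontsevichZagierPeriods.Theorems.SymplecticScissorsRealOnePeriodRelationsStubHomotopyInvarianceAux
import Literature.ModelTheory.ExponentialFields.SemialgebraicInterior
import Mathlib.Analysis.Complex.RealDeriv

/-!
# `RealOnePeriodRelations`, line `nash-retraction-thin-strip`, stub `stub_cellGreen` — auxiliary file 1

Generic `ℚ`-semialgebraic plumbing for the chart-cell Green instance (`stub_cellGreen`), with no new
definitions: composition of a semialgebraic path `[0,1] → ℂ` (realified) with a semialgebraic
`[0,1]`-valued function; passage from a dense subset to its closure for continuous functions (the closure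
of a semialgebraic set is semialgebraic); the derivative of a semialgebraic `C¹` path on the CLOSED
interval (registered anchor `helper_cellGreen_1`) and the complex derivative of a semialgebraic
holomorphic chart on the interior of its disc are semialgebraic (Basu–Pollack–Roy, Prop. 3.22); the
boundary identities of the bilinear Coons patch of four paths with matching corners.

References: J. Bochnak, M. Coste, M.-F. Roy, *Real Algebraic Geometry* (1998), §2.2; S. Basu, R. Pollack,
M.-F. Roy, *Algorithms in Real Algebraic Geometry* (2006), Prop. 3.22; M. Kontsevich, D. Zagier, *Periods*
(2001), §1.1–1.2.
-/

noncomputable section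

open scoped BigOperators Topology
open Set Filter Metric
open Literature.NumberTheory.Transcendental Literature.NumberTheory.Transcendental.CurvePeriods
open Literature.ModelTheory.ExponentialFields (IsSemialgebraic isSemialgebraic_closure
  isSemialgebraic_interior isSemialgebraic_setOf_eval_nonneg)
open Summit.KontsevichZagierPeriods.SymplecticScissors.RealOnePeriodRelationsNegative
  (unitDom isSemialgebraic_unitDom)
open Summit.KontsevichZagierPeriods.Theorems.StuffleInKZ.Negative.LogShadow (isSemialgebraic_Icc01)

namespace Summit.KontsevichZagierPeriods.SymplecticScissors.RealOnePeriodRelations.CellGreen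

/-! ## Sets -/

/-- The closed unit square is `ℚ`-semialgebraic. [folklore] -/
theorem isSemialgebraic_csq : IsSemialgebraic ℚ {p : Fin 2 → ℝ | 0 ≤ p 0 ∧ p 0 ≤ 1 ∧ 0 ≤ p 1 ∧ p 1 ≤ 1} := by
  have h : {p : Fin 2 → ℝ | 0 ≤ p 0 ∧ p 0 ≤ 1 ∧ 0 ≤ p 1 ∧ p 1 ≤ 1} =
      ({p : Fin 2 → ℝ | 0 ≤ MvPolynomial.aeval p (MvPolynomial.X 0 : MvPolynomial (Fin 2) ℚ)} ∩
      {p | 0 ≤ MvPolynomial.aeval p (1 - MvPolynomial.X 0 : MvPolynomial (Fin 2) ℚ)}) ∩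
      ({p | 0 ≤ MvPolynomial.aeval p (MvPolynomial.X 1 : MvPolynomial (Fin 2) ℚ)} ∩
      {p | 0 ≤ MvPolynomial.aeval p (1 - MvPolynomial.X 1 : MvPolynomial (Fin 2) ℚ)}) := by
    ext p
    simp [sub_nonneg, and_assoc]
  rw [h]
  exact ((isSemialgebraic_setOf_eval_nonneg _).inter (isSemialgebraic_setOf_eval_nonneg _)).inter
    ((isSemialgebraic_setOf_eval_nonneg _).inter (isSemialgebraic_setOf_eval_nonneg _))

/-- `closure (0,1) = [0,1]` inside `ℝ¹`. [folklore] -/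
theorem closure_unitDom : closure unitDom = {z : Fin 1 → ℝ | z 0 ∈ Set.Icc (0 : ℝ) 1} := by
  have h1 : unitDom = Set.pi univ (fun _ : Fin 1 => Set.Ioo (0 : ℝ) 1) := by
    ext z; simp [unitDom, Fin.forall_fin_one]
  have h2 : {z : Fin 1 → ℝ | z 0 ∈ Set.Icc (0 : ℝ) 1} = Set.pi univ (fun _ : Fin 1 => Set.Icc (0 : ℝ) 1) := by
    ext z; simp [Pi.le_def, Fin.forall_fin_one]
  rw [h1, h2, closure_pi_set]
  congr 1
  funext i
  exact closure_Ioo zero_ne_one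

/-! ## Complex-valued functions with semialgebraic real and imaginary parts -/

/-- The realified map `x ↦ (re F x, im F x)` is semialgebraic iff `re F`, `im F` are.
[cite: BochnakCosteRoy1998, §2.2] -/
theorem saMap_iff {m : ℕ} {s : Set (Fin m → ℝ)} (hs : IsSemialgebraic ℚ s) {F : (Fin m → ℝ) → ℂ} :
    IsSemialgebraicMapOn ℚ s (fun x => ![(F x).re, (F x).im]) ↔
      IsSemialgebraicFunOn ℚ s (fun x => (F x).re) ∧ IsSemialgebraicFunOn ℚ s (fun x => (F x).im) := by
  rw [isSemialgebraicMapOn_iff_forall_holds hs]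
  constructor
  · intro h
    exact ⟨by simpa using h 0, by simpa using h 1⟩
  · intro h j
    fin_cases j
    · simpa using h.1
    · simpa using h.2

/-- Composition of a semialgebraic path `F : [0,1] → ℂ` (realified) with a semialgebraic `[0,1]`-valued
function has semialgebraic real and imaginary parts. [cite: BochnakCosteRoy1998, Prop. 2.2.6] -/
theorem reImSA_comp {m : ℕ} {s : Set (Fin m → ℝ)} {F : ℝ → ℂ} {φ : (Fin m → ℝ) → ℝ}
    (hF : IsSemialgebraicMapOn ℚ {z : Fin 1 → ℝ | z 0 ∈ Set.Icc (0 : ℝ) 1} (fun z => ![(F (z 0)).re, (F (z 0)).im]))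
    (hs : IsSemialgebraic ℚ s) (hφ : IsSemialgebraicFunOn ℚ s φ)
    (hmaps : ∀ x ∈ s, φ x ∈ Set.Icc (0 : ℝ) 1) :
    IsSemialgebraicFunOn ℚ s (fun x => (F (φ x)).re) ∧ IsSemialgebraicFunOn ℚ s (fun x => (F (φ x)).im) := by
  have hΦ : IsSemialgebraicMapOn ℚ s (fun x (_ : Fin 1) => φ x) :=
    IsSemialgebraicMapOn.of_forall hs fun _ => hφ
  have hst : MapsTo (fun x (_ : Fin 1) => φ x) s {z : Fin 1 → ℝ | z 0 ∈ Set.Icc (0 : ℝ) 1} := fun x hx => hmaps x hx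
  have hc := (saMap_iff isSemialgebraic_Icc01).mp hF
  refine ⟨?_, ?_⟩
  · exact (IsSemialgebraicFunOn.comp_isSemialgebraicMapOn_holds hc.1 hΦ hst).congr fun x _ => by
      simp
  · exact (IsSemialgebraicFunOn.comp_isSemialgebraicMapOn_holds hc.2 hΦ hst).congr fun x _ => by
      simp

/-! ## From a dense subset to its closure -/

/-- A function continuous on `closure t` and `ℚ`-semialgebraic on `t` is `ℚ`-semialgebraic on
`closure t`: its graph there is the closure of its graph over `t`. [cite: BochnakCosteRoy1998, Prop. 2.2.2] -/
theorem sa_of_closure {m : ℕ} {s t : Set (Fin m → ℝ)} {f : (Fin m → ℝ) → ℝ}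
    (hf : IsSemialgebraicFunOn ℚ t f) (hct : closure t = s) (hc : ContinuousOn f s) :
    IsSemialgebraicFunOn ℚ s f := by
  set Φ : (Fin m → ℝ) → (Fin (m + 1) → ℝ) := fun x => Fin.snoc x (f x) with hΦ_def
  have himage : ∀ u : Set (Fin m → ℝ),
      {z : Fin (m + 1) → ℝ | ∃ x ∈ u, z = Fin.snoc x (f x)} = Φ '' u := by
    intro u
    ext z
    simp only [mem_setOf_eq, mem_image, hΦ_def]
    exact exists_congr fun x => and_congr_right fun _ => eq_comm
  have hinit : Continuous (Fin.init : (Fin (m + 1) → ℝ) → Fin m → ℝ) :=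
    continuous_pi fun i => continuous_apply _
  have hts : t ⊆ s := fun x hx => by rw [← hct]; exact subset_closure hx
  have hsc : IsClosed s := by rw [← hct]; exact isClosed_closure
  have hΦc : ContinuousOn Φ s := by
    refine continuousOn_pi.2 fun i => ?_
    induction i using Fin.lastCases with
    | last => simpa [hΦ_def] using hc
    | cast j => simpa [hΦ_def] using ((continuous_apply j).continuousOn (s := s))
  unfold IsSemialgebraicFunOn at hf ⊢
  rw [himage] at hf ⊢
  convert isSemialgebraic_closure hf using 1
  refine Subset.antisymm ?_ (closure_minimal (image_mono hts) ?_)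
  · have hΦc' : ContinuousOn Φ (closure t) := by rwa [hct]
    rw [← hct]
    exact hΦc'.image_closure
  · have hgraph : Φ '' s = {z : Fin (m + 1) → ℝ | Fin.init z ∈ s} ∩
        (fun z => z (Fin.last m) - f (Fin.init z)) ⁻¹' {0} := by
      ext z
      simp only [mem_image, mem_inter_iff, mem_setOf_eq, mem_preimage, mem_singleton_iff, hΦ_def]
      constructor
      · rintro ⟨x, hx, rfl⟩
        simpa using hx
      · rintro ⟨hz, h0⟩
        exact ⟨Fin.init z, hz, by rw [← sub_eq_zero.mp h0, Fin.snoc_init_self]⟩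
    rw [hgraph]
    refine ContinuousOn.preimage_isClosed_of_isClosed ?_ (hsc.preimage hinit) isClosed_singleton
    exact ((continuous_apply _).continuousOn).sub (hc.comp hinit.continuousOn fun z hz => hz)

/-! ## Derivatives of semialgebraic paths and charts -/

/-- A `C¹` path on `[0,1]` has derivative `derivWithin w [0,1] t` at interior times. [folklore] -/
theorem hasDerivAt_Icc {w : ℝ → ℂ} (hw : ContDiffOn ℝ 1 w (Set.Icc 0 1)) {t : ℝ}
    (ht : t ∈ Set.Ioo (0 : ℝ) 1) : HasDerivAt w (derivWithin w (Set.Icc 0 1) t) t :=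
  ((hw.differentiableOn one_ne_zero t (Ioo_subset_Icc_self ht)).hasDerivWithinAt).hasDerivAt
    (Icc_mem_nhds ht.1 ht.2)

/-- For a `C¹` path `w : [0,1] → ℂ` with `ℓ ∘ w` semialgebraic (`ℓ = re, im`), `ℓ ∘ w′` is semialgebraic
on the CLOSED interval, `w′ = derivWithin w [0,1]` (Basu–Pollack–Roy Prop. 3.22 on `(0,1)`, then closure by
continuity of `w′`). [cite: BasuPollackRoy2006, Prop. 3.22] -/
theorem sa_derivWithin_path {w : ℝ → ℂ} (hw : ContDiffOn ℝ 1 w (Set.Icc 0 1)) (ℓ : ℂ →L[ℝ] ℝ)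
    (hs : IsSemialgebraicFunOn ℚ {z : Fin 1 → ℝ | z 0 ∈ Set.Icc (0 : ℝ) 1} (fun z => ℓ (w (z 0)))) :
    IsSemialgebraicFunOn ℚ {z : Fin 1 → ℝ | z 0 ∈ Set.Icc (0 : ℝ) 1} (fun z => ℓ (derivWithin w (Set.Icc 0 1) (z 0))) := by
  have hsub : unitDom ⊆ {z : Fin 1 → ℝ | z 0 ∈ Set.Icc (0 : ℝ) 1} := fun z hz => Ioo_subset_Icc_self hz
  have h1 : IsSemialgebraicFunOn ℚ unitDom (fun z => ℓ (derivWithin w (Set.Icc 0 1) (z 0))) := by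
    refine IsSemialgebraicFunOn.hasDerivAt_isSemialgebraic_holds 0 1 (fun t => ℓ (w t))
      (fun t => ℓ (derivWithin w (Set.Icc 0 1) t)) zero_lt_one
      (hs.mono hsub isSemialgebraic_unitDom) ?_
    intro x hx
    exact ℓ.hasFDerivAt.comp_hasDerivAt x (hasDerivAt_Icc hw hx)
  have h2 : ContinuousOn (fun z : Fin 1 → ℝ => ℓ (derivWithin w (Set.Icc 0 1) (z 0))) {z : Fin 1 → ℝ | z 0 ∈ Set.Icc (0 : ℝ) 1} :=
    ℓ.continuous.comp_continuousOn
      ((hw.continuousOn_derivWithin (uniqueDiffOn_Icc zero_lt_one) le_rfl).comp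
        (continuous_apply 0).continuousOn fun z hz => hz)
  exact sa_of_closure h1 closure_unitDom h2

/-- The derivative `w′ = derivWithin w [0,1]` of a `ℚ`-semialgebraic `C¹` path `w : [0,1] → ℂ` is
`ℚ`-semialgebraic on `[0,1]` (realified). [cite: BasuPollackRoy2006, Prop. 3.22] -/
theorem saMap_derivWithin_path {w : ℝ → ℂ} (hw : ContDiffOn ℝ 1 w (Set.Icc 0 1))
    (hs : IsSemialgebraicMapOn ℚ {z : Fin 1 → ℝ | z 0 ∈ Set.Icc (0 : ℝ) 1} (fun z => ![(w (z 0)).re, (w (z 0)).im])) :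
    IsSemialgebraicMapOn ℚ {z : Fin 1 → ℝ | z 0 ∈ Set.Icc (0 : ℝ) 1} (fun z => ![(derivWithin w (Set.Icc 0 1) (z 0)).re,
      (derivWithin w (Set.Icc 0 1) (z 0)).im]) := by
  rw [saMap_iff isSemialgebraic_Icc01] at hs ⊢
  refine ⟨?_, ?_⟩
  · simpa using sa_derivWithin_path hw Complex.reCLM (by simpa using hs.1)
  · simpa using sa_derivWithin_path hw Complex.imCLM (by simpa using hs.2)

/-- For a chart `ψ` holomorphic on `ball c ε` with `ℓ ∘ ψᵢ` (`ℓ = re, im`) `ℚ`-semialgebraic on the realified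
closed disc `closedBall c ρ`, `ρ < ε`, the function `ℓ ∘ ψᵢ′` (complex derivative) is `ℚ`-semialgebraic on the
interior of the realified disc: `ψᵢ′ = ∂ψᵢ/∂x` is a line derivative (Basu–Pollack–Roy Prop. 3.22 and the
remark on partial derivatives). [cite: BasuPollackRoy2006, Prop. 3.22] -/
theorem sa_deriv_chart {n : ℕ} {c : ℂ} {ε ρ : ℝ} {ψ : ℂ → (Fin n → ℂ)} (hρε : ρ < ε)
    (hψ : AnalyticOnNhd ℂ ψ (ball c ε)) (i : Fin n) (ℓ : ℂ →L[ℝ] ℝ)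
    (hf : IsSemialgebraicFunOn ℚ {q : Fin 2 → ℝ | (⟨q 0, q 1⟩ : ℂ) ∈ closedBall c ρ}
      (fun q => ℓ (ψ ⟨q 0, q 1⟩ i))) :
    IsSemialgebraicFunOn ℚ (interior {q : Fin 2 → ℝ | (⟨q 0, q 1⟩ : ℂ) ∈ closedBall c ρ})
      (fun q => ℓ (deriv (fun u => ψ u i) ⟨q 0, q 1⟩)) := by
  set D := {q : Fin 2 → ℝ | (⟨q 0, q 1⟩ : ℂ) ∈ closedBall c ρ} with hD_def
  have hD : IsSemialgebraic ℚ D := IsSemialgebraicFunOn.isSemialgebraic_holds hf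
  refine IsSemialgebraicFunOn.of_hasLineDerivAt 0 hf (isSemialgebraic_interior hD) interior_subset
    (fun x hx => ?_) (fun x hx => ?_)
  · have hc : Continuous fun t : ℝ => x + t • (Pi.single 0 1 : Fin 2 → ℝ) := by fun_prop
    have hmem : ∀ᶠ t in 𝓝 (0 : ℝ), x + t • (Pi.single 0 1 : Fin 2 → ℝ) ∈ interior D :=
      hc.continuousAt.eventually_mem (by simpa using isOpen_interior.mem_nhds hx)
    exact hmem.mono fun t ht => interior_subset ht
  · have hxD' : x ∈ D := interior_subset hx
    have hxD : (⟨x 0, x 1⟩ : ℂ) ∈ ball c ε := closedBall_subset_ball hρε hxD'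
    have hd : HasDerivAt (fun u => ψ u i) (deriv (fun u => ψ u i) ⟨x 0, x 1⟩) ⟨x 0, x 1⟩ :=
      (differentiableAt_pi.1 (hψ _ hxD).differentiableAt i).hasDerivAt
    have hline : ∀ t : ℝ, (⟨(x + t • (Pi.single 0 1 : Fin 2 → ℝ)) 0,
        (x + t • (Pi.single 0 1 : Fin 2 → ℝ)) 1⟩ : ℂ) = ⟨x 0, x 1⟩ + (t : ℂ) := by
      intro t
      apply Complex.ext <;> simp
    unfold HasLineDerivAt
    simp_rw [hline]
    have hd' : HasDerivAt (fun u => ψ u i) (deriv (fun u => ψ u i) ⟨x 0, x 1⟩)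
        (⟨x 0, x 1⟩ + ((0 : ℝ) : ℂ)) := by simpa using hd
    have h3 : HasDerivAt (fun u : ℂ => ψ (⟨x 0, x 1⟩ + u) i) (deriv (fun u => ψ u i) ⟨x 0, x 1⟩)
        ((0 : ℝ) : ℂ) := hd'.comp_const_add _ _
    exact ℓ.hasFDerivAt.comp_hasDerivAt (0 : ℝ) h3.comp_ofReal

/-! ## Semialgebraic building blocks on the square -/

/-- The coordinates are semialgebraic on the square. [folklore] -/
theorem sa_coord (k : Fin 2) : IsSemialgebraicFunOn ℚ {p : Fin 2 → ℝ | 0 ≤ p 0 ∧ p 0 ≤ 1 ∧ 0 ≤ p 1 ∧ p 1 ≤ 1} (fun p => p k) :=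
  (isSemialgebraicFunOn_aeval isSemialgebraic_csq (MvPolynomial.X k)).congr fun p _ => by simp

/-- The coordinates, viewed in `ℂ`, have semialgebraic real and imaginary parts. [folklore] -/
theorem sa_ofReal_coord (k : Fin 2) :
    IsSemialgebraicFunOn ℚ {p : Fin 2 → ℝ | 0 ≤ p 0 ∧ p 0 ≤ 1 ∧ 0 ≤ p 1 ∧ p 1 ≤ 1} (fun p => ((p k : ℝ) : ℂ).re) ∧
      IsSemialgebraicFunOn ℚ {p : Fin 2 → ℝ | 0 ≤ p 0 ∧ p 0 ≤ 1 ∧ 0 ≤ p 1 ∧ p 1 ≤ 1} (fun p => ((p k : ℝ) : ℂ).im) :=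
  re_im_ofReal isSemialgebraic_csq (sa_coord k)

/-- The constant `1 ∈ ℂ` has semialgebraic real and imaginary parts on the square. [folklore] -/
theorem sa_one : IsSemialgebraicFunOn ℚ {p : Fin 2 → ℝ | 0 ≤ p 0 ∧ p 0 ≤ 1 ∧ 0 ≤ p 1 ∧ p 1 ≤ 1} (fun _ => (1 : ℂ).re) ∧
    IsSemialgebraicFunOn ℚ {p : Fin 2 → ℝ | 0 ≤ p 0 ∧ p 0 ≤ 1 ∧ 0 ≤ p 1 ∧ p 1 ≤ 1} (fun _ => (1 : ℂ).im) :=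
  ⟨by simpa using isSemialgebraicFunOn_natCast (k := ℚ) (R := ℝ) isSemialgebraic_csq 1,
    by simpa using isSemialgebraicFunOn_natCast (k := ℚ) (R := ℝ) isSemialgebraic_csq 0⟩

/-- On the square each coordinate lies in `[0,1]`. [folklore] -/
theorem coord_mem_Icc (k : Fin 2) {p : Fin 2 → ℝ} (hp : p ∈ {p : Fin 2 → ℝ | 0 ≤ p 0 ∧ p 0 ≤ 1 ∧ 0 ≤ p 1 ∧ p 1 ≤ 1}) :
    p k ∈ Set.Icc (0 : ℝ) 1 := by
  fin_cases k
  exacts [⟨hp.1, hp.2.1⟩, ⟨hp.2.2.1, hp.2.2.2⟩]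

/-- A semialgebraic path evaluated at a coordinate has semialgebraic real and imaginary parts on the
square. [cite: BochnakCosteRoy1998, Prop. 2.2.6] -/
theorem sa_path_coord {w : ℝ → ℂ}
    (hw : IsSemialgebraicMapOn ℚ {z : Fin 1 → ℝ | z 0 ∈ Set.Icc (0 : ℝ) 1} (fun z => ![(w (z 0)).re, (w (z 0)).im])) (k : Fin 2) :
    IsSemialgebraicFunOn ℚ {p : Fin 2 → ℝ | 0 ≤ p 0 ∧ p 0 ≤ 1 ∧ 0 ≤ p 1 ∧ p 1 ≤ 1} (fun p => (w (p k)).re) ∧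
      IsSemialgebraicFunOn ℚ {p : Fin 2 → ℝ | 0 ≤ p 0 ∧ p 0 ≤ 1 ∧ 0 ≤ p 1 ∧ p 1 ≤ 1} (fun p => (w (p k)).im) :=
  reImSA_comp hw isSemialgebraic_csq (sa_coord k) fun _ hp => coord_mem_Icc k hp

/-- The end point `w 0` of a semialgebraic path is a constant with semialgebraic real and imaginary
parts. [cite: BochnakCosteRoy1998, Prop. 2.2.6] -/
theorem sa_path_zero {w : ℝ → ℂ}
    (hw : IsSemialgebraicMapOn ℚ {z : Fin 1 → ℝ | z 0 ∈ Set.Icc (0 : ℝ) 1} (fun z => ![(w (z 0)).re, (w (z 0)).im])) :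
    IsSemialgebraicFunOn ℚ {p : Fin 2 → ℝ | 0 ≤ p 0 ∧ p 0 ≤ 1 ∧ 0 ≤ p 1 ∧ p 1 ≤ 1} (fun _ => (w 0).re) ∧
      IsSemialgebraicFunOn ℚ {p : Fin 2 → ℝ | 0 ≤ p 0 ∧ p 0 ≤ 1 ∧ 0 ≤ p 1 ∧ p 1 ≤ 1} (fun _ => (w 0).im) := by
  simpa using reImSA_comp hw isSemialgebraic_csq (isSemialgebraicFunOn_natCast isSemialgebraic_csq 0)
    (fun _ _ => by simp)

/-- The end point `w 1` of a semialgebraic path is a constant with semialgebraic real and imaginary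
parts. [cite: BochnakCosteRoy1998, Prop. 2.2.6] -/
theorem sa_path_one {w : ℝ → ℂ}
    (hw : IsSemialgebraicMapOn ℚ {z : Fin 1 → ℝ | z 0 ∈ Set.Icc (0 : ℝ) 1} (fun z => ![(w (z 0)).re, (w (z 0)).im])) :
    IsSemialgebraicFunOn ℚ {p : Fin 2 → ℝ | 0 ≤ p 0 ∧ p 0 ≤ 1 ∧ 0 ≤ p 1 ∧ p 1 ≤ 1} (fun _ => (w 1).re) ∧
      IsSemialgebraicFunOn ℚ {p : Fin 2 → ℝ | 0 ≤ p 0 ∧ p 0 ≤ 1 ∧ 0 ≤ p 1 ∧ p 1 ≤ 1} (fun _ => (w 1).im) := by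
  simpa using reImSA_comp hw isSemialgebraic_csq (isSemialgebraicFunOn_natCast isSemialgebraic_csq 1)
    (fun _ _ => by simp)

/-! ## Boundary identities of the bilinear Coons patch

The Coons patch of four paths `wb, wr, wt, wl` (bottom, right, top, left) and its partial derivatives are
handled through characterising hypotheses `hP`, `hPu`, `hPv` (no definitions). -/

section Coons

variable {wb wr wt wl : ℝ → ℂ} {P Pu Pv : (Fin 2 → ℝ) → ℂ}
  (h00 : wb 0 = wl 0) (h10 : wb 1 = wr 0) (h11 : wr 1 = wt 1) (h01 : wl 1 = wt 0)
  (hP : P = fun p => (1 - (p 1 : ℂ)) * wb (p 0) + (p 1 : ℂ) * wt (p 0) + (1 - (p 0 : ℂ)) * wl (p 1) +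
      (p 0 : ℂ) * wr (p 1) -
    ((1 - (p 0 : ℂ)) * (1 - (p 1 : ℂ)) * wb 0 + (p 0 : ℂ) * (1 - (p 1 : ℂ)) * wb 1 +
      (1 - (p 0 : ℂ)) * (p 1 : ℂ) * wt 0 + (p 0 : ℂ) * (p 1 : ℂ) * wt 1))
  (hPu : Pu = fun p => (1 - (p 1 : ℂ)) * derivWithin wb (Set.Icc 0 1) (p 0) +
      (p 1 : ℂ) * derivWithin wt (Set.Icc 0 1) (p 0) - wl (p 1) + wr (p 1) -
    (-(1 - (p 1 : ℂ)) * wb 0 + (1 - (p 1 : ℂ)) * wb 1 - (p 1 : ℂ) * wt 0 + (p 1 : ℂ) * wt 1))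
  (hPv : Pv = fun p => -wb (p 0) + wt (p 0) + (1 - (p 0 : ℂ)) * derivWithin wl (Set.Icc 0 1) (p 1) +
      (p 0 : ℂ) * derivWithin wr (Set.Icc 0 1) (p 1) -
    (-(1 - (p 0 : ℂ)) * wb 0 - (p 0 : ℂ) * wb 1 + (1 - (p 0 : ℂ)) * wt 0 + (p 0 : ℂ) * wt 1))

include h00 h10 hP in
/-- `P(t,0) = wb t`. [folklore] -/
theorem P_bottom (t : ℝ) : P ![t, 0] = wb t := by
  subst hP
  simp only [Matrix.cons_val_zero, Matrix.cons_val_one, Complex.ofReal_zero]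
  rw [← h00, ← h10]
  ring

include h11 h01 hP in
/-- `P(t,1) = wt t`. [folklore] -/
theorem P_top (t : ℝ) : P ![t, 1] = wt t := by
  subst hP
  simp only [Matrix.cons_val_zero, Matrix.cons_val_one, Complex.ofReal_one]
  rw [h11, h01]
  ring

include hP in
/-- `P(0,t) = wl t`. [folklore] -/
theorem P_left (t : ℝ) : P ![0, t] = wl t := by
  subst hP
  simp only [Matrix.cons_val_zero, Matrix.cons_val_one, Complex.ofReal_zero]
  ring

include hP in
/-- `P(1,t) = wr t`. [folklore] -/
theorem P_right (t : ℝ) : P ![1, t] = wr t := by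
  subst hP
  simp only [Matrix.cons_val_zero, Matrix.cons_val_one, Complex.ofReal_one]
  ring

include h00 h10 hPu in
/-- `∂ᵤP(t,0) = wb′ t`. [folklore] -/
theorem Pu_bottom (t : ℝ) : Pu ![t, 0] = derivWithin wb (Set.Icc 0 1) t := by
  subst hPu
  simp only [Matrix.cons_val_zero, Matrix.cons_val_one, Complex.ofReal_zero]
  rw [← h00, ← h10]
  ring

include h11 h01 hPu in
/-- `∂ᵤP(t,1) = wt′ t`. [folklore] -/
theorem Pu_top (t : ℝ) : Pu ![t, 1] = derivWithin wt (Set.Icc 0 1) t := by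
  subst hPu
  simp only [Matrix.cons_val_zero, Matrix.cons_val_one, Complex.ofReal_one]
  rw [h11, h01]
  ring

include hPv in
/-- `∂ᵥP(0,t) = wl′ t`. [folklore] -/
theorem Pv_left (t : ℝ) : Pv ![0, t] = derivWithin wl (Set.Icc 0 1) t := by
  subst hPv
  simp only [Matrix.cons_val_zero, Matrix.cons_val_one, Complex.ofReal_zero]
  ring

include hPv in
/-- `∂ᵥP(1,t) = wr′ t`. [folklore] -/
theorem Pv_right (t : ℝ) : Pv ![1, t] = derivWithin wr (Set.Icc 0 1) t := by
  subst hPv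
  simp only [Matrix.cons_val_zero, Matrix.cons_val_one, Complex.ofReal_one]
  ring

end Coons

end Summit.KontsevichZagierPeriods.SymplecticScissors.RealOnePeriodRelations.CellGreen

namespace Summit.KontsevichZagierPeriods.SymplecticScissors.RealOnePeriodRelations

/-- **Registered anchor `helper_cellGreen_1` (DERIVATIVES OF SEMIALGEBRAIC PATHS ON THE CLOSED INTERVAL).**
The derivative `w′ = derivWithin w [0,1]` (one-sided at the end points) of a `ℚ`-semialgebraic `C¹` path
`w : [0,1] → ℂ` is `ℚ`-semialgebraic on the CLOSED interval `[0,1]` (realified): Basu–Pollack–Roy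
Prop. 3.22 on `(0,1)`, then the closure of the graph by continuity of `w′`.
[cite: BasuPollackRoy2006, Prop. 3.22] -/
theorem helper_cellGreen_1 : ∀ (w : ℝ → ℂ), ContDiffOn ℝ 1 w (Set.Icc 0 1) → IsSemialgebraicMapOn ℚ {z : Fin 1 → ℝ | z 0 ∈ Set.Icc (0 : ℝ) 1} (fun z => ![(w (z 0)).re, (w (z 0)).im]) → IsSemialgebraicMapOn ℚ {z : Fin 1 → ℝ | z 0 ∈ Set.Icc (0 : ℝ) 1} (fun z => ![(derivWithin w (Set.Icc 0 1) (z 0)).re, (derivWithin w (Set.Icc 0 1) (z 0)).im]) :=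
  fun _ hw hs => CellGreen.saMap_derivWithin_path hw hs

end Summit.KontsevichZagierPeriods.SymplecticScissors.RealOnePeriodRelations

end
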